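import Summits.CriticalPhenomena.PercolationContinuityZ3.Theorems.PercAnnulusCrossingIICFarRider
import Summits.CriticalPhenomena.PercolationContinuityZ3.Theorems.PercAnnulusCrossingIICAspectSchemeLevel
import Summits.CriticalPhenomena.PercolationContinuityZ3.Theorems.PercAnnulusCrossingIICTop
import HarnessLib

/-!
# Kesten's IIC scheme with a far rider, II: SOURCE COMPARISON — the law of a far event given the arm from a rim is at least
# `ϰ²` times its law given the arm from the origin (lane RSW3, p1 gen 9)

builds on p205010 (kernel theorem, internal audit signed; external expert review pending)

Seat `prim-rsw3-p1` (gen 9); memo `run/shared/lean/prim/rsw3/P1-QM.md` §22.  Helper file; no definitions, no sorries; every `p`, `d`.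
Notation of parts XIII′ (`PercAnnulusCrossingIICAspectSchemeLevel.lean`: one level of Kesten's scheme at a general aspect `σ, τ` under
(A2)□(ϰ) — outer annulus `(σ M₁, σ M₂)` with data `D = (U,R)`, inward shell `(σ μ₁ − 1, σ μ₂)`, inner data `C = (H,X)`, kernel
`M(C;D) = P(GOOD_in ∩ LEFT(C;D) ∩ DAT(D) ∩ LINK'(D))`, level vectors `γ_n(D) = P(CONN(D;n))`) and of part I of this gen
(`PercAnnulusCrossingIICFarRider.lean`: a RIDER `G` determined by finitely many pairs disjoint from the pairs of `Λ(σ M₂ + 1)`).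
* **`sum_kernel_mul_rider_conn_two_sided_aspect`** — Kesten's eq. (22) with junk AND a rider:
  `P(G ∩ CONN(C;n)) − ϰ⁻²(α(σ μ₁,σ μ₂) + α(σ M₁,σ M₂))·γ_n(C) ≤ Σ_D M(C;D)·P(G ∩ CONN(D;n)) ≤ P(G ∩ CONN(C;n))`;
* `mul_sum_mul_sum_le_of_crossRatio`, `source_comparison_of_crossRatio` — finite-sum algebra: a kernel with cross-ratios `≤ c⁻¹`
  transports lower bounds between two sources (Kesten's Lemma (23) used as a transfer principle rather than as a contraction);
* **`sq_mul_le_real_rider_conn_mul_oneArmProb`** — THE SOURCE COMPARISON: with `J = ϰ⁻²(α(σ μ₁,σ μ₂) + α(σ M₁,σ M₂))`, for inner data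
  `H ⊆ Λ(m−1)`, `X ⊆ Λ(m)` (`τ m + 2 ≤ σ μ₁`) and every rider `G` beyond `Λ(σ M₂ + 1)`:
  `ϰ² · ((1 − J)·γ_n(H,X)) · max 0 (P(G ∩ {0 ↔ ∂ⁱⁿΛ(n)}) − J·π(n)) ≤ P(G ∩ CONN(H,X;n)) · π(n)`
  — i.e. up to the annulus junk `J` (which `θ(p) = 0` makes small), `P(G | X ↔ ∂ⁱⁿΛ(n) off H) ≥ ϰ²·P(G | 0 ↔ ∂ⁱⁿΛ(n))` UNIFORMLY in
  the source `(H,X)`: the two levels `Σ_D M(C;D)(·)` for `C` and for `C₀ = (∅,{0})` share the data `D`, and the kernel's cross-ratio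
  bound `ϰ² M(C;D) M(C₀;D') ≤ M(C;D') M(C₀;D)` (part XI′) exchanges the rider between them.
Use (part III of this gen, `…IICTailDecoupling`): with the first level carrying an inner cylinder `E`, `ν(E ∩ G) ≥ ϰ² ν(E) ν(G)` for
Kesten's IIC and every tail event `G`, whence the zero-one law.
References: H. Kesten, PTRF 73 (1986) §2 (eq. (22), Lemma (23)); D. Basu, A. Sapozhnikov, ECP 22 (2017) no. 26, §2 (2.5)–(2.8).
-/

noncomputable section

namespace Summit.CriticalPhenomena.PercolationContinuityZ3.Theorems.Crossing

open MeasureTheory Literature.Probability.Percolation Literature.Probability.LatticeModels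
open Literature.Probability.Percolation.DCT16
open Summit.CriticalPhenomena.PercolationContinuityZ3.Theorems.SurfaceTension
open scoped Literature.Probability.Percolation

variable {d : ℕ}

/-! ## One level of Kesten's scheme with junk and a rider -/

/-- **One level of Kesten's scheme at a general aspect, two-sided, carrying a far rider `G`**: see the module docstring.
[cite: Kesten1986, §2 eq. (22)] [cite: BasuSapozhnikov2017ECP, §2 (2.5)–(2.7)] -/
theorem sum_kernel_mul_rider_conn_two_sided_aspect (p : unitInterval) {ϰ : ℝ} (hϰ : 0 < ϰ)
    {σ τ : ℕ → ℕ} (hσ : ∀ m : ℕ, 1 ≤ m → m < σ m) (hστ : ∀ m : ℕ, 1 ≤ m → σ m < τ m)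
    (hσm : Monotone σ) (hτm : Monotone τ)
    (hA2 : ∀ m : ℕ, 1 ≤ m → ∀ Z : Finset (Site d), box d (τ m) \ box d (m - 1) ⊆ Z →
      ∀ X : Finset (Site d), X ⊆ Z ∩ box d m → ∀ Y : Finset (Site d), Y ⊆ Z \ box d (τ m) →
        ϰ * (bondPercolation (zdGraph d) p).real {ω | ∃ x ∈ X, ∃ s ∈ innerBoundary (zdGraph d) (box d (σ m)),
              ω ∈ openConnIn (↑Z : Set (Site d)) x s} *
          (bondPercolation (zdGraph d) p).real {ω | ∃ y ∈ Y, ∃ s ∈ innerBoundary (zdGraph d) (box d (σ m)),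
              ω ∈ openConnIn (↑Z : Set (Site d)) y s} ≤
        (bondPercolation (zdGraph d) p).real {ω | ∃ x ∈ X, ∃ y ∈ Y, ω ∈ openConnIn (↑Z : Set (Site d)) x y})
    {μ₁ μ₂ M₁ M₂ n : ℕ} (hμ₁ : 1 ≤ μ₁) (hμ12 : τ μ₁ < σ μ₂) (hμM : μ₂ ≤ M₁) (hM12 : τ M₁ < σ M₂) (hn : τ M₂ < n)
    {H X : Finset (Site d)} (hH : H ⊆ box d (μ₁ - 1)) (hX : X ⊆ box d μ₁) (hXH : ∀ x ∈ X, x ∉ H)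
    {G : Set (BondConfig (Site d))} {S : Finset (Sym2 (Site d))} (hG : DeterminedBy G ↑S)
    (hS : Disjoint S (box d (σ M₂ + 1)).sym2) :
    (bondPercolation (zdGraph d) p).real (G ∩ {ω : BondConfig (Site d) | ∃ x ∈ X, ∃ t ∈ innerBoundary (zdGraph d) (box d n),
            ω ∈ openConnIn ((↑(box d n) : Set (Site d)) \ ↑H) x t}) -
        ϰ⁻¹ ^ 2 * ((bondPercolation (zdGraph d) p).real (boxCrossing d (σ μ₁) (σ μ₂)) +
          (bondPercolation (zdGraph d) p).real (boxCrossing d (σ M₁) (σ M₂))) *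
          (bondPercolation (zdGraph d) p).real {ω : BondConfig (Site d) | ∃ x ∈ X, ∃ t ∈ innerBoundary (zdGraph d) (box d n),
            ω ∈ openConnIn ((↑(box d n) : Set (Site d)) \ ↑H) x t} ≤
      ∑ D ∈ ((box d (σ M₂)).powerset.filter (fun U => box d (σ M₁) ⊆ U)) ×ˢ (box d (σ M₂ + 1)).powerset,
        (bondPercolation (zdGraph d) p).real
        ((⋃ I ∈ (box d (σ μ₂ - 1) \ box d (σ μ₁ - 1)).powerset ×ˢ (innerBoundary (zdGraph d) (box d (σ μ₁ - 1))).powerset,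
            ({ω : BondConfig (Site d) | ω ∩ (↑((box d (σ μ₂)).sym2) : Set (Sym2 (Site d))) ∈
                explEvent ((↑(box d (σ μ₂ - 1)) : Set (Site d))ᶜ) ((↑(box d (σ μ₂ - 1)) : Set (Site d)) \ ↑(box d (σ μ₁ - 1)))
                  ((↑(box d (σ μ₂ - 1)) : Set (Site d))ᶜ ∪ ↑I.1) ↑I.2} ∩
             {ω : BondConfig (Site d) | ∀ y ∈ I.2, ∀ y' ∈ I.2, ∀ z ∈ I.1 ∪ innerBoundary (zdGraph d) (box d (σ μ₂)),
                ∀ z' ∈ I.1 ∪ innerBoundary (zdGraph d) (box d (σ μ₂)), s(z, y) ∈ ω → s(z', y') ∈ ω →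
                ω ∈ openConnIn (↑(I.1 ∪ innerBoundary (zdGraph d) (box d (σ μ₂))) : Set (Site d)) z z'})) ∩
          ({ω : BondConfig (Site d) | ∃ x ∈ X, ∃ r ∈ D.2, ∃ v ∈ D.1, ω ∈ openConnIn ((↑D.1 : Set (Site d)) \ ↑H) x v ∧ s(v, r) ∈ ω} ∩
           {ω : BondConfig (Site d) | ω ∩ (↑((box d (σ M₂ + 1)).sym2) : Set (Sym2 (Site d))) ∈
            explEvent (↑(box d (σ M₁)) : Set (Site d)) ((↑(box d (σ M₂)) : Set (Site d)) \ ↑(box d (σ M₁))) ↑D.1 ↑D.2} ∩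
           {ω : BondConfig (Site d) | ∀ r ∈ D.2, ∀ r' ∈ D.2, ∃ v ∈ D.1, ∃ v' ∈ D.1,
            s(v, r) ∈ ω ∧ s(v', r') ∈ ω ∧ ω ∈ openConnIn ((↑D.1 : Set (Site d)) \ ↑(box d (σ M₁ - 1))) v v'})) *
        (bondPercolation (zdGraph d) p).real (G ∩ {ω : BondConfig (Site d) | ∃ x ∈ D.2, ∃ t ∈ innerBoundary (zdGraph d) (box d n),
            ω ∈ openConnIn ((↑(box d n) : Set (Site d)) \ ↑D.1) x t}) ∧
      ∑ D ∈ ((box d (σ M₂)).powerset.filter (fun U => box d (σ M₁) ⊆ U)) ×ˢ (box d (σ M₂ + 1)).powerset,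
        (bondPercolation (zdGraph d) p).real
        ((⋃ I ∈ (box d (σ μ₂ - 1) \ box d (σ μ₁ - 1)).powerset ×ˢ (innerBoundary (zdGraph d) (box d (σ μ₁ - 1))).powerset,
            ({ω : BondConfig (Site d) | ω ∩ (↑((box d (σ μ₂)).sym2) : Set (Sym2 (Site d))) ∈
                explEvent ((↑(box d (σ μ₂ - 1)) : Set (Site d))ᶜ) ((↑(box d (σ μ₂ - 1)) : Set (Site d)) \ ↑(box d (σ μ₁ - 1)))
                  ((↑(box d (σ μ₂ - 1)) : Set (Site d))ᶜ ∪ ↑I.1) ↑I.2} ∩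
             {ω : BondConfig (Site d) | ∀ y ∈ I.2, ∀ y' ∈ I.2, ∀ z ∈ I.1 ∪ innerBoundary (zdGraph d) (box d (σ μ₂)),
                ∀ z' ∈ I.1 ∪ innerBoundary (zdGraph d) (box d (σ μ₂)), s(z, y) ∈ ω → s(z', y') ∈ ω →
                ω ∈ openConnIn (↑(I.1 ∪ innerBoundary (zdGraph d) (box d (σ μ₂))) : Set (Site d)) z z'})) ∩
          ({ω : BondConfig (Site d) | ∃ x ∈ X, ∃ r ∈ D.2, ∃ v ∈ D.1, ω ∈ openConnIn ((↑D.1 : Set (Site d)) \ ↑H) x v ∧ s(v, r) ∈ ω} ∩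
           {ω : BondConfig (Site d) | ω ∩ (↑((box d (σ M₂ + 1)).sym2) : Set (Sym2 (Site d))) ∈
            explEvent (↑(box d (σ M₁)) : Set (Site d)) ((↑(box d (σ M₂)) : Set (Site d)) \ ↑(box d (σ M₁))) ↑D.1 ↑D.2} ∩
           {ω : BondConfig (Site d) | ∀ r ∈ D.2, ∀ r' ∈ D.2, ∃ v ∈ D.1, ∃ v' ∈ D.1,
            s(v, r) ∈ ω ∧ s(v', r') ∈ ω ∧ ω ∈ openConnIn ((↑D.1 : Set (Site d)) \ ↑(box d (σ M₁ - 1))) v v'})) *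
        (bondPercolation (zdGraph d) p).real (G ∩ {ω : BondConfig (Site d) | ∃ x ∈ D.2, ∃ t ∈ innerBoundary (zdGraph d) (box d n),
            ω ∈ openConnIn ((↑(box d n) : Set (Site d)) \ ↑D.1) x t}) ≤
      (bondPercolation (zdGraph d) p).real (G ∩ {ω : BondConfig (Site d) | ∃ x ∈ X, ∃ t ∈ innerBoundary (zdGraph d) (box d n),
            ω ∈ openConnIn ((↑(box d n) : Set (Site d)) \ ↑H) x t}) := by
  classical
  have hσ1 := hσ μ₁ hμ₁
  have hστ1 := hστ μ₁ hμ₁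
  have hμ12' : μ₁ < μ₂ := hσm.reflect_lt (by omega)
  have hσ2 := hσ μ₂ (by omega)
  have hστ2 := hστ μ₂ (by omega)
  have hσμM : σ μ₂ ≤ σ M₁ := hσm hμM
  have hτμM : τ μ₂ ≤ τ M₁ := hτm hμM
  have hσM1 := hσ M₁ (by omega)
  have hστM1 := hστ M₁ (by omega)
  have hM12' : M₁ < M₂ := hσm.reflect_lt (by omega)
  have hσM2 := hσ M₂ (by omega)
  have hστM2 := hστ M₂ (by omega)
  set μ := bondPercolation (zdGraph d) p with hμ
  set Gin := (⋃ I ∈ (box d (σ μ₂ - 1) \ box d (σ μ₁ - 1)).powerset ×ˢ (innerBoundary (zdGraph d) (box d (σ μ₁ - 1))).powerset,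
            ({ω : BondConfig (Site d) | ω ∩ (↑((box d (σ μ₂)).sym2) : Set (Sym2 (Site d))) ∈
                explEvent ((↑(box d (σ μ₂ - 1)) : Set (Site d))ᶜ) ((↑(box d (σ μ₂ - 1)) : Set (Site d)) \ ↑(box d (σ μ₁ - 1)))
                  ((↑(box d (σ μ₂ - 1)) : Set (Site d))ᶜ ∪ ↑I.1) ↑I.2} ∩
             {ω : BondConfig (Site d) | ∀ y ∈ I.2, ∀ y' ∈ I.2, ∀ z ∈ I.1 ∪ innerBoundary (zdGraph d) (box d (σ μ₂)),
                ∀ z' ∈ I.1 ∪ innerBoundary (zdGraph d) (box d (σ μ₂)), s(z, y) ∈ ω → s(z', y') ∈ ω →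
                ω ∈ openConnIn (↑(I.1 ∪ innerBoundary (zdGraph d) (box d (σ μ₂))) : Set (Site d)) z z'})) with hGin
  set CO := {ω : BondConfig (Site d) | ∃ x ∈ X, ∃ t ∈ innerBoundary (zdGraph d) (box d n),
            ω ∈ openConnIn ((↑(box d n) : Set (Site d)) \ ↑H) x t} with hCO
  -- `GOOD_in` is determined by the pairs of `Λ(s)`
  have hGdet : DeterminedBy Gin (↑((box d (σ μ₂)).sym2) : Set (Sym2 (Site d))) := by
    refine DeterminedBy.iUnion fun I => DeterminedBy.iUnion fun hI => ?_
    rw [Finset.mem_product, Finset.mem_powerset, Finset.mem_powerset] at hI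
    have hT : {e : Sym2 (Site d) | e ∈ (↑((box d (σ μ₂)).sym2) : Set (Sym2 (Site d))) ∧
        ∃ v ∈ (↑(I.1 ∪ innerBoundary (zdGraph d) (box d (σ μ₂))) : Set (Site d)), v ∈ e} ⊆ ↑((box d (σ μ₂)).sym2) :=
      fun e he => he.1
    exact ((determinedBy_idat (c := σ μ₁ - 1) (by omega : 1 ≤ σ μ₂) I.1 I.2).mono hT).inter
      ((determinedBy_ilink (by omega : σ μ₁ - 1 ≤ σ μ₂) hI.1 hI.2).mono hT)
  have hF : (box d (σ μ₂)).sym2 ⊆ (box d (σ M₁)).sym2 := Finset.sym2_mono (box_mono d hσμM)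
  have h2 := sum_real_level_two_sided_aspect_rider p hϰ hσ hστ hA2 (m₁ := M₁) (m₂ := M₂) (n := n) (by omega) hM12'.le hM12 hn
    (hH.trans (box_mono d (by omega))) (hX.trans (box_mono d (by omega))) hXH hGdet hF hG hS
  -- reorder the intersections in the summands
  have hsum : ∀ D : Finset (Site d) × Finset (Site d),
      Gin ∩ {ω : BondConfig (Site d) | ω ∩ (↑((box d (σ M₂ + 1)).sym2) : Set (Sym2 (Site d))) ∈
            explEvent (↑(box d (σ M₁)) : Set (Site d)) ((↑(box d (σ M₂)) : Set (Site d)) \ ↑(box d (σ M₁))) ↑D.1 ↑D.2} ∩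
        {ω : BondConfig (Site d) | ∀ r ∈ D.2, ∀ r' ∈ D.2, ∃ v ∈ D.1, ∃ v' ∈ D.1,
            s(v, r) ∈ ω ∧ s(v', r') ∈ ω ∧ ω ∈ openConnIn ((↑D.1 : Set (Site d)) \ ↑(box d (σ M₁ - 1))) v v'} ∩
        {ω : BondConfig (Site d) | ∃ x ∈ X, ∃ r ∈ D.2, ∃ v ∈ D.1, ω ∈ openConnIn ((↑D.1 : Set (Site d)) \ ↑H) x v ∧ s(v, r) ∈ ω} =
      Gin ∩ ({ω : BondConfig (Site d) | ∃ x ∈ X, ∃ r ∈ D.2, ∃ v ∈ D.1, ω ∈ openConnIn ((↑D.1 : Set (Site d)) \ ↑H) x v ∧ s(v, r) ∈ ω} ∩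
        {ω : BondConfig (Site d) | ω ∩ (↑((box d (σ M₂ + 1)).sym2) : Set (Sym2 (Site d))) ∈
            explEvent (↑(box d (σ M₁)) : Set (Site d)) ((↑(box d (σ M₂)) : Set (Site d)) \ ↑(box d (σ M₁))) ↑D.1 ↑D.2} ∩
        {ω : BondConfig (Site d) | ∀ r ∈ D.2, ∀ r' ∈ D.2, ∃ v ∈ D.1, ∃ v' ∈ D.1,
            s(v, r) ∈ ω ∧ s(v', r') ∈ ω ∧ ω ∈ openConnIn ((↑D.1 : Set (Site d)) \ ↑(box d (σ M₁ - 1))) v v'}) := by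
    intro D; ext ω; simp only [Set.mem_inter_iff]; tauto
  simp only [hsum] at h2
  -- the GOOD_in complement inside CONN
  have hGm : MeasurableSet Gin := hGdet.measurableSet_of_finset
  have hjunk1 := real_inter_diff_goodIn_le p (c := σ μ₁ - 1) (s := σ μ₂) (by omega) CO
  rw [show σ μ₁ - 1 + 1 = σ μ₁ from by omega] at hjunk1
  have hjunk2 := real_conn_inter_nonuniq_le_of_setToSetQM_aspect p hϰ.le hσ hστ hA2 (m₁ := μ₁) (m₂ := μ₂) (n := n) (by omega)
    hμ12'.le hμ12 (by omega)
    hH hX hXH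
  have hϰ2 : 0 < ϰ ^ 2 := by positivity
  have hdiff : μ.real (CO \ Gin) ≤ ϰ⁻¹ ^ 2 * (μ.real (boxCrossing d (σ μ₁) (σ μ₂)) * μ.real CO) := by
    rw [inv_pow, le_inv_mul_iff₀ hϰ2]
    exact (mul_le_mul_of_nonneg_left hjunk1 hϰ2.le).trans hjunk2
  -- `G ∩ CO ⊆ (Gin ∩ G ∩ CO) ∪ (CO ∖ Gin)`
  have hsplit : μ.real (G ∩ CO) ≤ μ.real (Gin ∩ G ∩ CO) + μ.real (CO \ Gin) := by
    calc μ.real (G ∩ CO) ≤ μ.real ((Gin ∩ G ∩ CO) ∪ (CO \ Gin)) := by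
          refine measureReal_mono (fun ω hω => ?_) (measure_ne_top _ _)
          by_cases hωG : ω ∈ Gin
          · exact Or.inl ⟨⟨hωG, hω.1⟩, hω.2⟩
          · exact Or.inr ⟨hω.2, hωG⟩
      _ ≤ μ.real (Gin ∩ G ∩ CO) + μ.real (CO \ Gin) := measureReal_union_le _ _
  have hsub : μ.real (Gin ∩ G ∩ CO) ≤ μ.real (G ∩ CO) := measureReal_mono (fun ω hω => ⟨hω.1.2, hω.2⟩) (measure_ne_top _ _)
  constructor
  · have hlow := h2.1
    have hring : ϰ⁻¹ ^ 2 * (μ.real (boxCrossing d (σ μ₁) (σ μ₂)) + μ.real (boxCrossing d (σ M₁) (σ M₂))) * μ.real CO =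
        ϰ⁻¹ ^ 2 * (μ.real (boxCrossing d (σ μ₁) (σ μ₂)) * μ.real CO) +
          ϰ⁻¹ ^ 2 * μ.real (boxCrossing d (σ M₁) (σ M₂)) * μ.real CO := by ring
    rw [hring]
    linarith
  · exact h2.2.trans hsub

/-! ## Finite-sum algebra: a kernel with bounded cross-ratios transports lower bounds between sources -/

/-- **Cross-ratio bound, summed**: if `A, B ≥ 0` vanish off `good` and `c·A(i)B(j) ≤ A(j)B(i)` for good `i, j`, then for
`u, v ≥ 0`: `c · (Σ A u)(Σ B v) ≤ (Σ A v)(Σ B u)`. [cite: Kesten1986, §2 Lemma (23)] -/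
theorem mul_sum_mul_sum_le_of_crossRatio {ι : Type*} (s : Finset ι) (good : ι → Prop)
    {c : ℝ} {A B u v : ι → ℝ} (hu : ∀ i ∈ s, 0 ≤ u i) (hv : ∀ i ∈ s, 0 ≤ v i)
    (hA0 : ∀ i ∈ s, ¬ good i → A i = 0) (hB0 : ∀ i ∈ s, ¬ good i → B i = 0)
    (hcr : ∀ i ∈ s, ∀ j ∈ s, good i → good j → c * (A i * B j) ≤ A j * B i) :
    c * ((∑ i ∈ s, A i * u i) * (∑ j ∈ s, B j * v j)) ≤ (∑ j ∈ s, A j * v j) * (∑ i ∈ s, B i * u i) := by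
  calc c * ((∑ i ∈ s, A i * u i) * (∑ j ∈ s, B j * v j))
      = ∑ i ∈ s, ∑ j ∈ s, c * (A i * u i * (B j * v j)) := by
        rw [Finset.sum_mul_sum, Finset.mul_sum]
        refine Finset.sum_congr rfl fun i _ => ?_
        rw [Finset.mul_sum]
    _ ≤ ∑ i ∈ s, ∑ j ∈ s, A j * v j * (B i * u i) := by
        refine Finset.sum_le_sum fun i hi => Finset.sum_le_sum fun j hj => ?_
        by_cases hgi : good i
        · by_cases hgj : good j
          · have h := mul_le_mul_of_nonneg_right (hcr i hi j hj hgi hgj) (mul_nonneg (hu i hi) (hv j hj))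
            calc c * (A i * u i * (B j * v j)) = c * (A i * B j) * (u i * v j) := by ring
              _ ≤ A j * B i * (u i * v j) := h
              _ = A j * v j * (B i * u i) := by ring
          · rw [hB0 j hj hgj, hA0 j hj hgj]; simp
        · rw [hA0 i hi hgi, hB0 i hi hgi]; simp
    _ = (∑ j ∈ s, A j * v j) * (∑ i ∈ s, B i * u i) := by
        rw [Finset.sum_mul_sum, Finset.sum_comm]

/-- **Source comparison from a cross-ratio bound** (abstract form of the two-level argument): given the four one-level
inequalities `(1−J)γ_C ≤ Σ A u`, `P_G − J π ≤ Σ B v`, `Σ A v ≤ P_{G,C}`, `Σ B u ≤ π` for a kernel pair `(A, B)` (sources `C` and `0`)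
with cross-ratios `≤ c⁻¹` and level vectors `u` (bare arm) and `v` (arm with rider), one gets
`c · ((1−J)γ_C) · max 0 (P_G − Jπ) ≤ P_{G,C} · π`. [cite: Kesten1986, §2 Lemma (23)] -/
theorem source_comparison_of_crossRatio {ι : Type*} (s : Finset ι) (good : ι → Prop)
    {c J γC PG π PGC : ℝ} {A B u v : ι → ℝ} (hc : 0 ≤ c)
    (hA : ∀ i ∈ s, 0 ≤ A i) (hB : ∀ i ∈ s, 0 ≤ B i) (hu : ∀ i ∈ s, 0 ≤ u i) (hv : ∀ i ∈ s, 0 ≤ v i)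
    (hA0 : ∀ i ∈ s, ¬ good i → A i = 0) (hB0 : ∀ i ∈ s, ¬ good i → B i = 0)
    (hcr : ∀ i ∈ s, ∀ j ∈ s, good i → good j → c * (A i * B j) ≤ A j * B i)
    (h1 : (1 - J) * γC ≤ ∑ i ∈ s, A i * u i) (h2 : PG - J * π ≤ ∑ i ∈ s, B i * v i)
    (h3 : ∑ i ∈ s, A i * v i ≤ PGC) (h4 : ∑ i ∈ s, B i * u i ≤ π) :
    c * ((1 - J) * γC) * max 0 (PG - J * π) ≤ PGC * π := by
  have hSAv : 0 ≤ ∑ i ∈ s, A i * v i := Finset.sum_nonneg fun i hi => mul_nonneg (hA i hi) (hv i hi)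
  have hSBu : 0 ≤ ∑ i ∈ s, B i * u i := Finset.sum_nonneg fun i hi => mul_nonneg (hB i hi) (hu i hi)
  have hSBv : 0 ≤ ∑ i ∈ s, B i * v i := Finset.sum_nonneg fun i hi => mul_nonneg (hB i hi) (hv i hi)
  have hPGC : 0 ≤ PGC := hSAv.trans h3
  have hπ : 0 ≤ π := hSBu.trans h4
  rcases le_or_gt (PG - J * π) 0 with hY | hY
  · rw [max_eq_left hY, mul_zero]
    exact mul_nonneg hPGC hπ
  rw [max_eq_right hY.le]
  rcases lt_or_ge ((1 - J) * γC) 0 with hX | hX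
  · have : c * ((1 - J) * γC) * (PG - J * π) ≤ 0 :=
      mul_nonpos_of_nonpos_of_nonneg (mul_nonpos_of_nonneg_of_nonpos hc hX.le) hY.le
    exact this.trans (mul_nonneg hPGC hπ)
  have hcross := mul_sum_mul_sum_le_of_crossRatio s good hu hv hA0 hB0 hcr
  calc c * ((1 - J) * γC) * (PG - J * π)
      ≤ c * ((∑ i ∈ s, A i * u i) * (∑ j ∈ s, B j * v j)) := by
        rw [mul_assoc]
        exact mul_le_mul_of_nonneg_left (mul_le_mul h1 h2 hY.le (hX.trans h1)) hc
    _ ≤ (∑ j ∈ s, A j * v j) * (∑ i ∈ s, B i * u i) := hcross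
    _ ≤ PGC * π := mul_le_mul h3 h4 hSBu hPGC

/-! ## The source comparison -/

/-- **SOURCE COMPARISON FOR FAR EVENTS** (two levels of Kesten's scheme sharing their outer data): under (A2)□(ϰ) at a general aspect
(`σ, τ` monotone, `m < σ m < τ m`), with scales `1 ≤ m`, `τ m + 2 ≤ σ μ₁`, `τ μ₁ < σ μ₂`, `μ₂ ≤ M₁`, `τ M₁ < σ M₂`, `τ M₂ < n`, junk
`J = ϰ⁻²(α(σ μ₁, σ μ₂) + α(σ M₁, σ M₂))`, inner data `H ⊆ Λ(m−1)`, `X ⊆ Λ(m)`, `X ∩ H = ∅`, and a rider `G` determined by finitely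
many pairs disjoint from the pairs of `Λ(σ M₂ + 1)`:
`ϰ² · ((1 − J) · P(CONN(H,X;n))) · max 0 (P(G ∩ {0 ↔ ∂ⁱⁿΛ(n)}) − J · π_p(n)) ≤ P(G ∩ CONN(H,X;n)) · π_p(n)`.
Reading: `P(G | X ↔ ∂ⁱⁿΛ(n) in Λ(n) ∖ H) ≥ ϰ² · P(G | 0 ↔ ∂ⁱⁿΛ(n))` up to the junk, uniformly in the source.
[cite: Kesten1986, §2 eq. (22), Lemma (23)] [cite: BasuSapozhnikov2017ECP, §2 (2.5)–(2.8)] -/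
theorem sq_mul_le_real_rider_conn_mul_oneArmProb (p : unitInterval) {ϰ : ℝ} (hϰ : 0 < ϰ)
    {σ τ : ℕ → ℕ} (hσ : ∀ m : ℕ, 1 ≤ m → m < σ m) (hστ : ∀ m : ℕ, 1 ≤ m → σ m < τ m)
    (hσm : Monotone σ) (hτm : Monotone τ)
    (hA2 : ∀ m : ℕ, 1 ≤ m → ∀ Z : Finset (Site d), box d (τ m) \ box d (m - 1) ⊆ Z →
      ∀ X : Finset (Site d), X ⊆ Z ∩ box d m → ∀ Y : Finset (Site d), Y ⊆ Z \ box d (τ m) →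
        ϰ * (bondPercolation (zdGraph d) p).real {ω | ∃ x ∈ X, ∃ s ∈ innerBoundary (zdGraph d) (box d (σ m)),
              ω ∈ openConnIn (↑Z : Set (Site d)) x s} *
          (bondPercolation (zdGraph d) p).real {ω | ∃ y ∈ Y, ∃ s ∈ innerBoundary (zdGraph d) (box d (σ m)),
              ω ∈ openConnIn (↑Z : Set (Site d)) y s} ≤
        (bondPercolation (zdGraph d) p).real {ω | ∃ x ∈ X, ∃ y ∈ Y, ω ∈ openConnIn (↑Z : Set (Site d)) x y})
    {m μ₁ μ₂ M₁ M₂ n : ℕ} (hm : 1 ≤ m) (hmμ : τ m + 2 ≤ σ μ₁) (hμ12 : τ μ₁ < σ μ₂) (hμM : μ₂ ≤ M₁)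
    (hM12 : τ M₁ < σ M₂) (hn : τ M₂ < n)
    {H X : Finset (Site d)} (hH : H ⊆ box d (m - 1)) (hX : X ⊆ box d m) (hXH : ∀ x ∈ X, x ∉ H)
    {G : Set (BondConfig (Site d))} {S : Finset (Sym2 (Site d))} (hG : DeterminedBy G ↑S)
    (hS : Disjoint S (box d (σ M₂ + 1)).sym2) :
    ϰ ^ 2 * ((1 - ϰ⁻¹ ^ 2 * ((bondPercolation (zdGraph d) p).real (boxCrossing d (σ μ₁) (σ μ₂)) +
        (bondPercolation (zdGraph d) p).real (boxCrossing d (σ M₁) (σ M₂)))) *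
        (bondPercolation (zdGraph d) p).real {ω : BondConfig (Site d) | ∃ x ∈ X, ∃ t ∈ innerBoundary (zdGraph d) (box d n),
            ω ∈ openConnIn ((↑(box d n) : Set (Site d)) \ ↑H) x t}) *
      max 0 ((bondPercolation (zdGraph d) p).real (G ∩ siteToBoundary d n) -
        ϰ⁻¹ ^ 2 * ((bondPercolation (zdGraph d) p).real (boxCrossing d (σ μ₁) (σ μ₂)) +
          (bondPercolation (zdGraph d) p).real (boxCrossing d (σ M₁) (σ M₂))) * oneArmProb d p n) ≤
      (bondPercolation (zdGraph d) p).real (G ∩ {ω : BondConfig (Site d) | ∃ x ∈ X, ∃ t ∈ innerBoundary (zdGraph d) (box d n),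
            ω ∈ openConnIn ((↑(box d n) : Set (Site d)) \ ↑H) x t}) * oneArmProb d p n := by
  classical
  have hσ0 := hσ m hm
  have hστ0 := hστ m hm
  have hmμ' : m < μ₁ := hσm.reflect_lt (by omega)
  have hμ₁ : 1 ≤ μ₁ := by omega
  have hσ1 := hσ μ₁ hμ₁
  have hστ1 := hστ μ₁ hμ₁
  have hμ12' : μ₁ < μ₂ := hσm.reflect_lt (by omega)
  have hM1 : 1 ≤ M₁ := by omega
  have hσM1 := hσ M₁ hM1
  have hστM1 := hστ M₁ hM1
  have hM12' : M₁ < M₂ := hσm.reflect_lt (by omega)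
  have hHμ : H ⊆ box d (μ₁ - 1) := hH.trans (box_mono d (by omega))
  have hXμ : X ⊆ box d μ₁ := hX.trans (box_mono d (by omega))
  have h0H : (∅ : Finset (Site d)) ⊆ box d (m - 1) := Finset.empty_subset _
  have h0X : ({0} : Finset (Site d)) ⊆ box d m := Finset.singleton_subset_iff.2 (zero_mem_box d m)
  have h0XH : ∀ x ∈ ({0} : Finset (Site d)), x ∉ (∅ : Finset (Site d)) := fun x _ => Finset.notMem_empty x
  have hKC := sum_kernel_mul_conn_two_sided_aspect p hϰ hσ hστ hσm hτm hA2 hμ₁ hμ12 hμM hM12 hn hHμ hXμ hXH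
  have hK0 := sum_kernel_mul_conn_two_sided_aspect p hϰ hσ hστ hσm hτm hA2 hμ₁ hμ12 hμM hM12 hn
    (h0H.trans (box_mono d (by omega))) (h0X.trans (box_mono d (by omega))) h0XH
  have hRC := sum_kernel_mul_rider_conn_two_sided_aspect p hϰ hσ hστ hσm hτm hA2 hμ₁ hμ12 hμM hM12 hn hHμ hXμ hXH hG hS
  have hR0 := sum_kernel_mul_rider_conn_two_sided_aspect p hϰ hσ hστ hσm hτm hA2 hμ₁ hμ12 hμM hM12 hn
    (h0H.trans (box_mono d (by omega))) (h0X.trans (box_mono d (by omega))) h0XH hG hS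
  rw [conn_empty_zero_eq] at hK0 hR0
  rw [show oneArmProb d p n = (bondPercolation (zdGraph d) p).real (siteToBoundary d n) from rfl]
  refine source_comparison_of_crossRatio
    (((box d (σ M₂)).powerset.filter (fun U => box d (σ M₁) ⊆ U)) ×ˢ (box d (σ M₂ + 1)).powerset)
    (fun D => ∀ r ∈ D.2, r ∉ box d (σ M₂)) (pow_pos hϰ 2).le ?_ ?_ ?_ ?_ ?_ ?_ ?_ hKC.1 hR0.1 hRC.2 hK0.2
  · exact fun _ _ => measureReal_nonneg
  · exact fun _ _ => measureReal_nonneg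
  · exact fun _ _ => measureReal_nonneg
  · exact fun _ _ => measureReal_nonneg
  · -- a datum whose rim meets the box has probability zero (source `C`)
    intro D hD hbad
    push Not at hbad
    obtain ⟨r, hr, hrb⟩ := hbad
    rw [Finset.mem_product, Finset.mem_filter, Finset.mem_powerset, Finset.mem_powerset] at hD
    exact le_antisymm ((measureReal_mono (fun ω hω => hω.2.1.2) (measure_ne_top _ _)).trans
      (real_dat_eq_zero_of_mem_box p (hσm hM12'.le) hD.1.1 hr hrb).le) measureReal_nonneg
  · -- the same for the source `0`
    intro D hD hbad
    push Not at hbad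
    obtain ⟨r, hr, hrb⟩ := hbad
    rw [Finset.mem_product, Finset.mem_filter, Finset.mem_powerset, Finset.mem_powerset] at hD
    exact le_antisymm ((measureReal_mono (fun ω hω => hω.2.1.2) (measure_ne_top _ _)).trans
      (real_dat_eq_zero_of_mem_box p (hσm hM12'.le) hD.1.1 hr hrb).le) measureReal_nonneg
  · -- the cross-ratio bound of part XI′
    intro D hD D' hD' hgD hgD'
    rw [Finset.mem_product, Finset.mem_filter, Finset.mem_powerset, Finset.mem_powerset] at hD hD'
    exact kernel_crossRatio_le_aspect p hϰ.le hσ hστ hA2 hm (c := σ μ₁ - 1) (s := σ μ₂) (a := σ M₁) (b := σ M₂)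
      (by omega) (by omega) (hσm hμM) (hσm hM12'.le) hH hX hXH h0H h0X h0XH
      hD.1.2 hD.1.1 hD.2 hgD hD'.1.2 hD'.1.1 hD'.2 hgD'

end Summit.CriticalPhenomena.PercolationContinuityZ3.Theorems.Crossing

end
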